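import Literature.AlgebraicGeometry.Frobenioids.Thm36Sub
import Literature.AlgebraicGeometry.Frobenioids.PerfectionEndomorphisms
import Literature.AlgebraicGeometry.Frobenioids.PerfectionIsos
import Literature.AlgebraicGeometry.Frobenioids.ArchimedeanUnitCircle
import Literature.AlgebraicGeometry.Frobenioids.ArchimedeanUnitStabilizersThm36v
import Literature.AlgebraicGeometry.Frobenioids.ArchimedeanFrobeniusIsotropic
import Literature.AlgebraicGeometry.Frobenioids.ArchimedeanUnitMonoids
import Mathlib.RingTheory.Localization.BaseChange
import Mathlib.Analysis.Complex.Polynomial.Basic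
import HarnessLib

/-!
# Frobenioids II, Thm. 3.6 (v) for `C^ℚ := C^pf`: the units `O^×((A, n))` of THE perfection of the archimedean
# Frobenioid — level representatives, transport between Frobenius powers, normalised scalars (part 1 of 2)

Mochizuki, *The geometry of Frobenioids II: poly-Frobenioids*, Kyushu J. Math. **62** (2008) 401–460, §3,
Thm. 3.6 (v) p. 37 (kurims text `paper:url-4322d76898e0`) for `F = C^ℚ := C^pf` (Ex. 3.3 (ii) p. 28)
[cite: MochizukiFrdII2008, Thm 3.6 (v) p.37]; the perfection `C^pf` is [FrdI] Def. 3.1 (ii)(iii) pp. 56–57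
[cite: MochizukiFrdI2008, Def. 3.1 (iii) p.57].  Companion of the sub-DAG statements file `Thm36Sub.lean`
(abc-iut cell, layer L1, `SUBDAG-FrdII-Thm36-Prop35`, slot `Thm36Sub.v_Q`; seat abc-iut-w5-d237, roadmap of
abc-iut-w4-d027): the bookkeeping of `O^×((A, n)) = lim_→ O^×(A^{(c)})`, the inductive limit of the unit groups
of the CHOSEN Frobenius powers `A^{(c)}` along the Prop. 1.10 (i) transports (abc-iut-L1-d9's `Perfection*` API),
for THE perfection of the archimedean Frobenioid `C → F_Φ` of Ex. 3.3 over any base `π : D → D₀` (abc-iut-L1-t6;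
units of `C`: abc-iut-L1-t9 / L6-d7).  Contents: every `u ∈ O^×((A, n))` is the class `[θ]` of a unit
`θ ∈ O^×(A^{(c)})` (`exists_unit_rep`, via the "isomorphism" clause of [FrdI] Prop. 3.2 (ii)); the transport
`θ′` of `θ` to `A^{(c′)}` is a unit with scalar the Galois twist (of the base of `A^{(c)} → A^{(c′)}`) of
`z^{c′/c}` (`scalar_liftUnit`), so that on NORMALISED scalars (twisted back along the base of `A → A^{(c)}`)
the transition maps are the pure powers `z ↦ z^{c′/c}` (`normScalar_liftUnit`); `[θ] = 1` once a power of its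
scalar is `1`; hence **`O^×((A, n)) = {1}` for `A` real** (`unitsSubgroup_eq_bot_of_isReal`, clause (b)); the
values `ns(θ) ⊗ 1/c ∈ S¹ ⊗_ℤ ℚ` (`levelVal`, `unitVal`) whose bijectivity for complex `A` is part 2
(`Thm36SubPerfectionUnitsQ.lean`).  Proofs and auxiliary constructions only: no notion of the paper is
(re)defined, no statement strengthened; nothing here bears on [IUTchIII] Cor. 3.12.
-/

noncomputable section

namespace Literature.AlgebraicGeometry.Frobenioids

open CategoryTheory Opposite
open scoped TensorProduct

universe v u

namespace ArchFrd

namespace Thm36Sub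

variable {D : Type u} [Category.{v} D] (π : D ⥤ D0)

/-- Membership in `O^×((A, n))` for the structure functor `pfStr` of THE perfection is membership for
abc-iut-L1-d9's operations `Perfection.ops` (definitional). [cite: MochizukiFrdI2008, Prop. 3.2 (i) p.58] -/
theorem mem_unitsSubgroup_pfStr_iff (hF : PreFrobenioid.IsFrobenioid (C.toElem π))
    (X : pfCat π hF) (u : Aut X) :
    u ∈ PreFrobenioid.unitsSubgroup (pfStr π hF) X ↔
      (PreFrobenioid.Perfection.ops hF).IsBaseIdentity u.hom ∧
        (PreFrobenioid.Perfection.ops hF).IsLinear (X := X) (Y := X) u.hom :=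
  Iff.rfl

/-- `(A, n)` is a real object (for `baseRC π`) iff the base of `A` is `Spec ℝ`.
[cite: MochizukiFrdII2008, Def 3.1 (v) p.24] -/
theorem realObjects_pf_iff (hF : PreFrobenioid.IsFrobenioid (C.toElem π)) (X : pfCat π hF) :
    RC.realObjects (PreFrobenioid.baseFunctor (pfStr π hF) ⋙ baseRC π) X ↔ (π.obj X.obj.snd).IsReal :=
  D0.isReal_toArchBase_iff _

/-- `(A, n)` is a complex object (for `baseRC π`) iff the base of `A` is `Spec ℂ`.
[cite: MochizukiFrdII2008, Def 3.1 (v) p.24] -/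
theorem complexObjects_pf_iff (hF : PreFrobenioid.IsFrobenioid (C.toElem π)) (X : pfCat π hF) :
    RC.complexObjects (PreFrobenioid.baseFunctor (pfStr π hF) ⋙ baseRC π) X ↔
      (π.obj X.obj.snd).IsComplex :=
  D0.isComplex_toArchBase_iff _

/-- Every element of `O_ℂ^× = S¹` has an `m`-th root, `m ≥ 1` (`ℂ` is algebraically closed; the divisibility of
`S¹` behind Lemma 3.2 (v)). [cite: MochizukiFrdII2008, Lem 3.2 (v) p.25] -/
theorem normOne_exists_pow_eq (w : normOneSubgroup ℂ) (m : ℕ+) :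
    ∃ v : normOneSubgroup ℂ, v ^ (m : ℕ) = w := by
  obtain ⟨z, hz⟩ := IsAlgClosed.exists_pow_nat_eq ((w : ℂˣ) : ℂ) m.pos
  have hz0 : z ≠ 0 := by
    intro h
    rw [h, zero_pow m.ne_zero] at hz
    exact (w : ℂˣ).ne_zero hz.symm
  have hnorm : ‖z‖ = 1 := by
    have h1 : ‖z‖ ^ (m : ℕ) = 1 := by
      rw [← norm_pow, hz]
      exact (mem_normOneSubgroup_iff ℂ _).mp w.2
    exact (pow_eq_one_iff_of_nonneg (norm_nonneg z) m.ne_zero).mp h1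
  refine ⟨⟨Units.mk0 z hz0, (mem_normOneSubgroup_iff ℂ _).mpr hnorm⟩, ?_⟩
  apply Subtype.ext
  apply Units.ext
  rw [SubmonoidClass.coe_pow, Units.val_pow_eq_pow_val, Units.val_mk0, hz]

/-- A norm-one unit of `ℂ` as an element of Mathlib's `Circle` (junk value `1` off the unit circle). [folklore] -/
def unitCirc (z : ℂˣ) : Circle :=
  if h : ‖(z : ℂ)‖ = 1 then ⟨(z : ℂ), mem_sphere_zero_iff_norm.mpr h⟩ else 1

/-- `unitCirc z` is `z` (bookkeeping for "`O^×(A) ≅ S¹ ⊗_ℤ ℚ`", Mathlib's `Circle` as `S¹`). [cite: MochizukiFrdII2008, Thm 3.6 (v) p.37] -/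
theorem coe_unitCirc {z : ℂˣ} (h : ‖(z : ℂ)‖ = 1) : (unitCirc z : ℂ) = z := by
  rw [unitCirc, dif_pos h]

/-- `unitCirc` is multiplicative on norm-one units. [cite: MochizukiFrdII2008, Thm 3.6 (v) p.37] -/
theorem unitCirc_mul {z w : ℂˣ} (hz : ‖(z : ℂ)‖ = 1) (hw : ‖(w : ℂ)‖ = 1) :
    unitCirc (z * w) = unitCirc z * unitCirc w := by
  have hzw : ‖((z * w : ℂˣ) : ℂ)‖ = 1 := by rw [Units.val_mul, norm_mul, hz, hw, mul_one]
  exact Circle.ext (by rw [coe_unitCirc hzw, Circle.coe_mul, coe_unitCirc hz, coe_unitCirc hw,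
    Units.val_mul])

/-- `unitCirc 1 = 1`. [cite: MochizukiFrdII2008, Thm 3.6 (v) p.37] -/
theorem unitCirc_one : unitCirc 1 = 1 :=
  Circle.ext (by rw [coe_unitCirc (by rw [Units.val_one, norm_one]), Units.val_one, Circle.coe_one])

/-- `unitCirc` commutes with powers. [cite: MochizukiFrdII2008, Thm 3.6 (v) p.37] -/
theorem unitCirc_pow {z : ℂˣ} (hz : ‖(z : ℂ)‖ = 1) (n : ℕ) : unitCirc (z ^ n) = unitCirc z ^ n := by
  induction n with
  | zero => rw [pow_zero, pow_zero, unitCirc_one]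
  | succ n ih =>
    rw [pow_succ, pow_succ, unitCirc_mul (by rw [Units.val_pow_eq_pow_val, norm_pow, hz, one_pow]) hz,
      ih]

/-- `unitCirc z = 1` iff `z = 1`. [cite: MochizukiFrdII2008, Thm 3.6 (v) p.37] -/
theorem unitCirc_eq_one_iff {z : ℂˣ} (hz : ‖(z : ℂ)‖ = 1) : unitCirc z = 1 ↔ z = 1 := by
  rw [← Circle.coe_eq_one, coe_unitCirc hz, Units.val_eq_one]

/-- `unitCirc` is a left inverse of `Circle.toUnits`. [cite: MochizukiFrdII2008, Thm 3.6 (v) p.37] -/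
theorem unitCirc_toUnits (y : Circle) : unitCirc (Circle.toUnits y) = y :=
  Circle.ext (by rw [coe_unitCirc (by rw [Circle.toUnits_apply, Units.val_mk0]; exact y.norm_coe),
    Circle.toUnits_apply, Units.val_mk0])

section Levels

variable {π}
variable {hF : PreFrobenioid.IsFrobenioid (C.toElem π)} (X : pfCat π hF)

open PreFrobenioid PreFrobenioid.Perfection

/-- The `D`-component of the chosen Frobenius morphism `A → A^{(c)}` is an isomorphism (morphisms of
Frobenius type are base-isomorphisms). [cite: MochizukiFrdI2008, Def. 1.3 (ii) p.24] -/
theorem isIso_snd_frob (c : ℕ+) : IsIso (frob hF X.obj c).snd :=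
  isIso_base_frob hF X.obj c

/-- The Frobenius powers of a complex object are complex. [cite: MochizukiFrdII2008, Def 3.1 (v) p.24] -/
theorem isComplex_frobPow (hX : (π.obj X.obj.snd).IsComplex) (c : ℕ+) :
    (π.obj (frobPow hF X.obj c).snd).IsComplex := by
  haveI := isIso_snd_frob X c
  exact D0.isComplex_of_hom (inv (π.map (frob hF X.obj c).snd)) hX

/-- The Frobenius powers of a real object are real. [cite: MochizukiFrdII2008, Def 3.1 (v) p.24] -/
theorem isReal_frobPow (hX : (π.obj X.obj.snd).IsReal) (c : ℕ+) :
    (π.obj (frobPow hF X.obj c).snd).IsReal :=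
  UnitStab.isReal_of_not_isComplex π _ fun hc =>
    UnitStab.not_isComplex_of_isReal π X.obj hX (D0.isComplex_of_hom (π.map (frob hF X.obj c).snd) hc)

/-- The `C₀`-components of the Frobenius powers of a complex object are complex.
[cite: MochizukiFrdII2008, Def 3.1 (v) p.24] -/
theorem isComplexObj_frobPow (hX : (π.obj X.obj.snd).IsComplex) (c : ℕ+) :
    (frobPow hF X.obj c).fst.IsComplexObj :=
  UnitStab.isComplexObj_fst_of π _ (isComplex_frobPow X hX c)

/-- **Cofinally many Frobenius powers `A^{(c)}` are naively isotropic**: if `B^{n₀} = S¹` for the angular part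
`B` of `A` (Lemma 3.2 (v)), then `A^{(c)}` is naively isotropic for every multiple `c` of `n₀`.
[cite: MochizukiFrdII2008, Lem 3.2 (v) p.25] -/
theorem exists_isotropic_levels :
    ∃ n₀ : ℕ+, ∀ c : ℕ+, n₀ ∣ c → (frobPow hF X.obj c).fst.IsNaivelyIsotropic := by
  obtain ⟨n₀, hn₀⟩ := X.obj.fst.region.exists_pow_surjOn
  refine ⟨n₀, fun c hc => ?_⟩
  obtain ⟨m, rfl⟩ := hc
  apply C0.isNaivelyIsotropic_of_hom_of_pow_surj (frob hF X.obj (n₀ * m)).fst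
  intro w
  have hdeg : C0.degFr (frob hF X.obj (n₀ * m)).fst = n₀ * m := degFr_frob hF X.obj (n₀ * m)
  obtain ⟨w', hw'⟩ := normOne_exists_pow_eq w m
  obtain ⟨z, hz, hzw⟩ := hn₀ w'
  exact ⟨z, hz, by rw [hdeg, PNat.mul_coe, pow_mul, hzw, hw']⟩

/-- **Every `u ∈ O^×((A, n))` is the class, at some diagonal level `(c, c)`, of some `θ ∈ O^×(A^{(c)})`**
(Def. 3.1 (ii) with the "isomorphism" clause of Prop. 3.2 (ii): an isomorphism of `C^pf` is represented by
isomorphisms of `C` at all sufficiently high levels). [cite: MochizukiFrdI2008, Prop. 3.2 (ii) p.59] -/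
theorem exists_unit_rep (u : Aut X) (hu : u ∈ unitsSubgroup (pfStr π hF) X) :
    ∃ (c : ℕ+) (θ : Aut (frobPow hF X.obj c)),
      θ ∈ unitsSubgroup (C.toElem π) (frobPow hF X.obj c) ∧ endClass X c θ.hom = u.hom := by
  obtain ⟨c, θ₀, hθ₀⟩ := exists_endClass_eq X u.hom
  have hiso : IsIso (X := X) (Y := X) (Hom.mk ⟨Level.diag X c, θ₀⟩) := by
    rw [← endClass_def, hθ₀]; infer_instance
  obtain ⟨N, hN, hI⟩ := exists_isIso_lift_of_isIso ⟨Level.diag X c, θ₀⟩ hiso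
  obtain ⟨a, b, hab⟩ := N
  obtain rfl : a = b := mul_left_cancel hab
  haveI : IsIso (Level.lift (Level.diag X c) ⟨a, a, hab⟩ hN θ₀) := hI
  have hcl : endClass X a (Level.lift (Level.diag X c) ⟨a, a, hab⟩ hN θ₀) = u.hom :=
    (endClass_liftLevel X hN.1 θ₀ _).trans hθ₀
  refine ⟨a, asIso (Level.lift (Level.diag X c) ⟨a, a, hab⟩ hN θ₀), ⟨?_, ?_⟩, hcl⟩
  · exact (isBaseIdentity_endClass_iff X a _).mp (by rw [asIso_hom, hcl]; exact hu.1)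
  · exact (isLinear_endClass_iff X a _).mp (by rw [asIso_hom, hcl]; exact hu.2)

/-- The class `[θ]` at the level `(c, c)` of an automorphism `θ` of `A^{(c)}`, as an automorphism of `(A, n)`.
[cite: MochizukiFrdI2008, Def. 3.1 (iii) p.57] -/
def classAut (c : ℕ+) (θ : Aut (frobPow hF X.obj c)) : Aut X where
  hom := endClass X c θ.hom
  inv := endClass X c θ.inv
  hom_inv_id := by rw [endClass_comp, Iso.hom_inv_id, endClass_id]
  inv_hom_id := by rw [endClass_comp, Iso.inv_hom_id, endClass_id]

/-- `[θ] ∈ O^×((A, n))` for `θ ∈ O^×(A^{(c)})`. [cite: MochizukiFrdI2008, Prop. 3.2 (i) p.58] -/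
theorem classAut_mem (c : ℕ+) (θ : Aut (frobPow hF X.obj c))
    (hθ : θ ∈ unitsSubgroup (C.toElem π) (frobPow hF X.obj c)) :
    classAut X c θ ∈ unitsSubgroup (pfStr π hF) X :=
  ⟨(isBaseIdentity_endClass_iff X c θ.hom).mpr hθ.1, (isLinear_endClass_iff X c θ.hom).mpr hθ.2⟩

/-- `[1] = 1`. [cite: MochizukiFrdI2008, Def. 3.1 (iii) p.57] -/
theorem classAut_one (c : ℕ+) : classAut X c (1 : Aut (frobPow hF X.obj c)) = 1 :=
  Iso.ext (endClass_id X c)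

/-- `θ ↦ [θ]`, `Aut(A^{(c)}) → Aut((A, n))`, as a homomorphism of groups. [cite: MochizukiFrdI2008, Def. 3.1 (iii) p.57] -/
def classAutHom (c : ℕ+) : Aut (frobPow hF X.obj c) →* Aut X where
  toFun := classAut X c
  map_one' := classAut_one X c
  map_mul' θ θ' := Iso.ext (by
    change endClass X c (θ'.hom ≫ θ.hom) = endClass X c θ'.hom ≫ endClass X c θ.hom
    rw [endClass_comp])

/-- `[θ θ′] = [θ] [θ′]`. [cite: MochizukiFrdI2008, Def. 3.1 (iii) p.57] -/
theorem classAut_mul (c : ℕ+) (θ θ' : Aut (frobPow hF X.obj c)) :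
    classAut X c (θ * θ') = classAut X c θ * classAut X c θ' :=
  map_mul (classAutHom X c) θ θ'

/-- `[θ ^ n] = [θ] ^ n`. [cite: MochizukiFrdI2008, Def. 3.1 (iii) p.57] -/
theorem classAut_pow (c : ℕ+) (θ : Aut (frobPow hF X.obj c)) (n : ℕ) :
    classAut X c (θ ^ n) = classAut X c θ ^ n :=
  map_pow (classAutHom X c) θ n

/-- The transport `θ′` of `θ ∈ Aut(A^{(c)})` to `A^{(c′)}` (`c ∣ c′`; the Prop. 1.10 (i) conjugate along the
transition `A^{(c)} → A^{(c′)}`), as an automorphism. [cite: MochizukiFrdI2008, Prop. 1.10 (i) p.34] -/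
def liftUnit {c c' : ℕ+} (h : c ∣ c') (θ : Aut (frobPow hF X.obj c)) : Aut (frobPow hF X.obj c') :=
  haveI : IsIso (Level.lift (Level.diag X c) (Level.diag X c') ⟨h, h⟩ θ.hom) :=
    isIso_lift (Level.diag X c) (Level.diag X c') ⟨h, h⟩ θ.hom inferInstance
  asIso (Level.lift (Level.diag X c) (Level.diag X c') ⟨h, h⟩ θ.hom)

/-- The defining square of the transport: `(A^{(c)} → A^{(c′)}) ≫ θ′ = θ ≫ (A^{(c)} → A^{(c′)})`.
[cite: MochizukiFrdI2008, Prop. 1.10 (i) p.34] -/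
theorem frobTrans_liftUnit {c c' : ℕ+} (h : c ∣ c') (θ : Aut (frobPow hF X.obj c)) :
    frobTrans hF X.obj h ≫ (liftUnit X h θ).hom = θ.hom ≫ frobTrans hF X.obj h :=
  liftLevel_spec hF θ.hom h h rfl

/-- The transport of a unit is a unit. [cite: MochizukiFrdI2008, Prop. 1.10 (i) p.34] -/
theorem liftUnit_mem {c c' : ℕ+} (h : c ∣ c') (θ : Aut (frobPow hF X.obj c))
    (hθ : θ ∈ unitsSubgroup (C.toElem π) (frobPow hF X.obj c)) :
    liftUnit X h θ ∈ unitsSubgroup (C.toElem π) (frobPow hF X.obj c') := by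
  have hm : End.of θ.hom ∈ endSubmonoid (C.toElem π) (frobPow hF X.obj c) := hθ
  exact (liftLevel_mem_iff X h (End.of θ.hom) rfl).mpr hm

/-- The class of the transport is the class: `[θ′] = [θ]`. [cite: MochizukiFrdI2008, Def. 3.1 (ii) p.56] -/
theorem classAut_liftUnit {c c' : ℕ+} (h : c ∣ c') (θ : Aut (frobPow hF X.obj c)) :
    classAut X c' (liftUnit X h θ) = classAut X c θ :=
  Iso.ext (endClass_liftLevel X h θ.hom rfl)

/-- **The scalar of the transport**: if `θ ∈ O^×(A^{(c)})` has scalar `z`, its transport to `A^{(c′)}` along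
the transition `A^{(c)} → A^{(c′)}` of degree `k = c′/c` has scalar the Galois twist, of the base of the
transition, of `z ^ k` (composition law of Example 3.3 (i): `scalar(ψ ≫ φ) = Base(ψ)^*(scalar φ) · scalar(ψ)^{deg φ}`).
[cite: MochizukiFrdII2008, Ex 3.3 (i) p.27] -/
theorem scalar_liftUnit {c c' : ℕ+} (h : c ∣ c') (θ : Aut (frobPow hF X.obj c))
    (hθ : θ ∈ unitsSubgroup (C.toElem π) (frobPow hF X.obj c)) :
    C0.scalar (liftUnit X h θ).hom.fst =
      D0.galAct (D0.Hom.twists (C0.Base (frobTrans hF X.obj h).fst))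
        (C0.scalar θ.hom.fst ^ (C0.degFr (frobTrans hF X.obj h).fst : ℕ)) := by
  have hsq := congrArg (fun f => C0.scalar (CFP.Hom.fst f)) (frobTrans_liftUnit X h θ)
  simp only [CFP.comp_fst, C0.scalar_comp'] at hsq
  have hb : C0.Base θ.hom.fst = 𝟙 _ := UnitStab.base_fst_eq_id π _ θ hθ
  have hd : C0.degFr (liftUnit X h θ).hom.fst = 1 := (liftUnit_mem X h θ hθ).2
  rw [hb, hd, PNat.one_coe, pow_one] at hsq
  change D0.galAct (D0.Hom.twists (C0.Base (frobTrans hF X.obj h).fst)) _ * _ =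
    D0.galAct (D0.Hom.twists (𝟙 _)) _ * _ at hsq
  rw [D0.twists_id, D0.galAct_false, mul_comm] at hsq
  have hsq' := mul_left_cancel hsq
  rw [← hsq', D0.galAct_galAct]

/-- The Galois twist (`false` = identity, `true` = complex conjugation) of the base of the chosen Frobenius
morphism `A → A^{(c)}`, read on the `C₀`-components. [cite: MochizukiFrdII2008, Def 3.1 (iv) p.24] -/
def levelTwist (c : ℕ+) : Bool := D0.Hom.twists (C0.Base (frob hF X.obj c).fst)

/-- The **normalised scalar** `ns(θ)` of `θ ∈ O^×(A^{(c)})`: its scalar `z ∈ O_K^×` twisted back along the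
base of `A → A^{(c)}` (so that the transition maps of the inductive system become pure powers).
[cite: MochizukiFrdII2008, Thm 3.6 (v) p.37] -/
def normScalar (c : ℕ+) (θ : Aut (frobPow hF X.obj c)) : ℂˣ :=
  D0.galAct (levelTwist X c) (C0.scalar θ.hom.fst)

/-- The normalised scalar of a unit has absolute value `1`. [cite: MochizukiFrdII2008, Thm 3.6 (v) p.37] -/
theorem norm_normScalar (c : ℕ+) (θ : Aut (frobPow hF X.obj c))
    (hθ : θ ∈ unitsSubgroup (C.toElem π) (frobPow hF X.obj c)) :
    ‖(normScalar X c θ : ℂ)‖ = 1 := by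
  rw [normScalar, D0.norm_galAct]
  exact UnitStab.norm_scalar_eq_one π _ θ hθ

/-- The scalar of a product of units is the product of the scalars. [cite: MochizukiFrdII2008, Ex 3.3 (i) p.27] -/
theorem scalar_mul (c : ℕ+) (θ θ' : Aut (frobPow hF X.obj c))
    (hθ : θ ∈ unitsSubgroup (C.toElem π) (frobPow hF X.obj c))
    (hθ' : θ' ∈ unitsSubgroup (C.toElem π) (frobPow hF X.obj c)) :
    C0.scalar (θ * θ').hom.fst = C0.scalar θ.hom.fst * C0.scalar θ'.hom.fst := by
  change C0.scalar (θ'.hom ≫ θ.hom).fst = _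
  rw [CFP.comp_fst, C0.scalar_comp', UnitStab.base_fst_eq_id π _ θ' hθ',
    show C0.degFr θ.hom.fst = 1 from hθ.2, PNat.one_coe, pow_one]
  change D0.galAct (D0.Hom.twists (𝟙 _)) _ * _ = _
  rw [D0.twists_id, D0.galAct_false]

/-- The normalised scalar is multiplicative. [cite: MochizukiFrdII2008, Thm 3.6 (v) p.37] -/
theorem normScalar_mul (c : ℕ+) (θ θ' : Aut (frobPow hF X.obj c))
    (hθ : θ ∈ unitsSubgroup (C.toElem π) (frobPow hF X.obj c))
    (hθ' : θ' ∈ unitsSubgroup (C.toElem π) (frobPow hF X.obj c)) :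
    normScalar X c (θ * θ') = normScalar X c θ * normScalar X c θ' := by
  rw [normScalar, scalar_mul X c θ θ' hθ hθ', map_mul]; rfl

/-- The scalar of the identity is `1`. [cite: MochizukiFrdII2008, Ex 3.3 (i) p.27] -/
theorem scalar_one (c : ℕ+) : C0.scalar (1 : Aut (frobPow hF X.obj c)).hom.fst = 1 := rfl

/-- The normalised scalar of the identity is `1`. [cite: MochizukiFrdII2008, Thm 3.6 (v) p.37] -/
theorem normScalar_one (c : ℕ+) : normScalar X c 1 = 1 := by
  rw [normScalar, scalar_one, map_one]

/-- Degrees along a transition: `c · deg_Fr(A^{(c)} → A^{(c′)}) = c′`. [cite: MochizukiFrdI2008, Def. 3.1 (ii) p.56] -/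
theorem mul_degFr_frobTrans {c c' : ℕ+} (h : c ∣ c') :
    c * C0.degFr (frobTrans hF X.obj h).fst = c' :=
  degFr_frobTrans hF X.obj h

/-- The scalar of an endomorphism of `A^{(c)}` is a scalar for the base field of ANY `A^{(c″)}` (all the
Frobenius powers of `A` are real, resp. complex, together with `A`). [cite: MochizukiFrdII2008, Def 3.1 (i) p.23] -/
theorem scalar_mem_scalars_frobPow (c c'' : ℕ+) (θ : Aut (frobPow hF X.obj c)) :
    C0.scalar θ.hom.fst ∈ D0.scalars (frobPow hF X.obj c'').fst.base := by
  rcases D0.isReal_or_isComplex (π.obj X.obj.snd) with hX | hX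
  · have h1 : (frobPow hF X.obj c).fst.base = .real :=
      UnitStab.D0.isReal_of_hom_real (frobPow hF X.obj c).iso.inv (isReal_frobPow X hX c)
    have h2 : (frobPow hF X.obj c'').fst.base = .real :=
      UnitStab.D0.isReal_of_hom_real (frobPow hF X.obj c'').iso.inv (isReal_frobPow X hX c'')
    rw [h2]
    exact h1 ▸ θ.hom.fst.scalar_mem
  · have h2 : (frobPow hF X.obj c'').fst.base = .complex := isComplexObj_frobPow X hX c''
    rw [h2, D0.scalars_complex]
    exact Subgroup.mem_top _

/-- **The transition maps of the inductive system `c ↦ O^×(A^{(c)})` are pure powers on normalised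
scalars**: `ns(θ′) = ns(θ)^{c′/c}` for the transport `θ′` of `θ` to `A^{(c′)}`. [cite: MochizukiFrdII2008, Thm 3.6 (v) p.37] -/
theorem normScalar_liftUnit {c c' : ℕ+} (h : c ∣ c') (θ : Aut (frobPow hF X.obj c))
    (hθ : θ ∈ unitsSubgroup (C.toElem π) (frobPow hF X.obj c)) :
    normScalar X c' (liftUnit X h θ) = normScalar X c θ ^ (C0.degFr (frobTrans hF X.obj h).fst : ℕ) := by
  unfold normScalar levelTwist
  rw [scalar_liftUnit X h θ hθ, ← map_pow, ← frob_frobTrans hF X.obj h, CFP.comp_fst, C0.base_comp',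
    D0.galAct_twists_comp _ _
      (D0.galAct_mem_scalars _ (pow_mem (scalar_mem_scalars_frobPow X c c' θ) _)),
    D0.galAct_galAct]

/-- A unit of a Frobenius power whose scalar is a root of unity, `z^N = 1`, has TRIVIAL class in
`O^×((A, n))` (transport it to `A^{(cN)}`, where its scalar becomes `1`). [cite: MochizukiFrdII2008, Thm 3.6 (v) p.37] -/
theorem classAut_eq_one_of_pow_eq_one (c : ℕ+) (θ : Aut (frobPow hF X.obj c))
    (hθ : θ ∈ unitsSubgroup (C.toElem π) (frobPow hF X.obj c)) (N : ℕ+)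
    (hN : C0.scalar θ.hom.fst ^ (N : ℕ) = 1) : classAut X c θ = 1 := by
  have h : c ∣ c * N := dvd_mul_right c N
  have hk : C0.degFr (frobTrans hF X.obj h).fst = N := mul_left_cancel (mul_degFr_frobTrans X h)
  have hs : C0.scalar (liftUnit X h θ).hom.fst = 1 := by
    rw [scalar_liftUnit X h θ hθ, hk, hN, map_one]
  have h1 : liftUnit X h θ = 1 :=
    UnitStab.eq_of_scalar_eq π _ _ 1 (liftUnit_mem X h θ hθ) (one_mem _) (by rw [hs]; rfl)
  rw [← classAut_liftUnit X h θ, h1, classAut_one]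

/-- **Thm. 3.6 (v) (b) for `C^ℚ`, the mechanism**: over a REAL `A`, every unit of `(A, n)` is trivial — a unit
of the (real) Frobenius power `A^{(c)}` has scalar `±1`, which squares to `1` along `A^{(c)} → A^{(2c)}`.
[cite: MochizukiFrdII2008, Thm 3.6 (v) p.37] -/
theorem eq_one_of_isReal (hX : (π.obj X.obj.snd).IsReal) (u : Aut X)
    (hu : u ∈ unitsSubgroup (pfStr π hF) X) : u = 1 := by
  obtain ⟨c, θ, hθ, hcl⟩ := exists_unit_rep X u hu
  have hreal : (frobPow hF X.obj c).fst.base = .real :=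
    UnitStab.D0.isReal_of_hom_real (frobPow hF X.obj c).iso.inv (isReal_frobPow X hX c)
  have hmem : C0.scalar θ.hom.fst ∈ D0.scalars .real := hreal ▸ θ.hom.fst.scalar_mem
  have hsq : C0.scalar θ.hom.fst ^ ((2 : ℕ+) : ℕ) = 1 := by
    rcases UnitStab.eq_one_or_eq_neg_one_of_mem_scalars_real hmem
      (UnitStab.norm_scalar_eq_one π _ θ hθ) with h | h
    · rw [h, one_pow]
    · rw [h]; exact neg_one_sq
  have hu' : u = classAut X c θ := Iso.ext hcl.symm
  rw [hu', classAut_eq_one_of_pow_eq_one X c θ hθ 2 hsq]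

/-- **`O^×((A, n)) = {1}` for `A` real** (Thm. 3.6 (v): "`O^×(A)` is trivial if … (b) `Λ = ℚ` and `A` is
real"). [cite: MochizukiFrdII2008, Thm 3.6 (v) p.37] -/
theorem unitsSubgroup_eq_bot_of_isReal (hX : (π.obj X.obj.snd).IsReal) :
    unitsSubgroup (pfStr π hF) X = ⊥ :=
  (Subgroup.eq_bot_iff_forall _).mpr fun u hu => eq_one_of_isReal X hX u hu

/-- The value `ns(θ) ⊗ (1/c) ∈ S¹ ⊗_ℤ ℚ` of a unit `θ ∈ O^×(A^{(c)})` (compatible with the transition maps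
`z ↦ z^{c′/c}`: `z^k ⊗ 1/(ck) = z ⊗ 1/c`). [cite: MochizukiFrdII2008, Thm 3.6 (v) p.37] -/
def levelVal (c : ℕ+) (θ : Aut (frobPow hF X.obj c)) : Additive Circle ⊗[ℤ] ℚ :=
  Additive.ofMul (unitCirc (normScalar X c θ)) ⊗ₜ[ℤ] ((c : ℚ)⁻¹)

/-- **The value map `O^×((A, n)) → S¹ ⊗_ℤ ℚ`**, `[θ] ↦ ns(θ) ⊗ (1/c)` for a chosen representative
`θ ∈ O^×(A^{(c)})` (independence of the choice, additivity and bijectivity: part 2).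
[cite: MochizukiFrdII2008, Thm 3.6 (v) p.37] -/
def unitVal (u : unitsSubgroup (pfStr π hF) X) : Additive Circle ⊗[ℤ] ℚ :=
  levelVal X (exists_unit_rep X u.1 u.2).choose (exists_unit_rep X u.1 u.2).choose_spec.choose

end Levels

end Thm36Sub

end ArchFrd

end Literature.AlgebraicGeometry.Frobenioids

end
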